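import Summits.ValiantsHypothesis.ValiantsHypothesis.Theorems.NewtonUnitEquationsTwoProductsMomentRecordLiftClassSum
import Summits.ValiantsHypothesis.ValiantsHypothesis.Theorems.NewtonUnitEquationsTwoProductsMomentRecordRungDefs
import Summits.ValiantsHypothesis.ValiantsHypothesis.Theorems.NewtonUnitEquationsTwoProductsFormalLogLinearisationStubLogLinearisation
import Summits.ValiantsHypothesis.ValiantsHypothesis.Theorems.NewtonUnitEquationsTwoProductsSubmergedReduction

/-!
# R12 lift toolkit — the record of a visible point and the glue of record

(5/5) **THE RECORD OF A VISIBLE POINT** (`exists_liveTop_of_isStrictTop`, `exists_isRecord_of_isStrictTop`): for a normalised instance with tail alphabet in `X ⊔ (X+d)`, carrier-dissociated to depth `m` (the LANDED hypothesis; no all-depth version needed), a valid `ξ` and a strict `ξ`-top `l` of `supp(Π(1+u) − Π(1+v))`, the shallow pair over `l` is LIVE for the data of the instance and a RECORD (`IsRecord`) for the same `ξ`, which is `NegWeightUsed` (R1); reindexing to the `≤ 2mt` occurring carriers; and ★ **the glue of record `shiftedCarrier_of_lawUsed_holds : shiftedCarrier_of_lawUsed`** (= `MomentRecordLawUsed →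 ShiftedCarrierLaw`, crit-8 g2 W4 rev 3).
Helper on crux `stmt-ValiantsHypothesis-5906` (line `relation_ladder`, R12 «moment record law», crit-8 g2's texts ✓ `…MomentRecordDefs` / `…MomentRecordRungDefs`); `--supports`, closes nothing by itself: (A∘) `MomentRecordLawUsed`, the rung (B), `PlanarCellBound` and the crux stay OPEN; VP ≠ VNP is NOT proved.  No instances, no notation, no named facts. [folklore]
-/

set_option linter.dupNamespace false

noncomputable section

open Classical

namespace Summit.ValiantsHypothesis.ValiantsHypothesis.Theorems.NewtonUnitEquations.TwoProducts.MomentRecord.Lift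
open scoped BigOperators
open MvPolynomial

section RecordFile

section NegUsed
open Summit.ValiantsHypothesis.ValiantsHypothesis.Theorems.NewtonUnitEquations.TwoProducts.FormalLogLinearisation
open Summit.ValiantsHypothesis.ValiantsHypothesis.Theorems.NewtonUnitEquations.TwoProducts.PlanarCell
open Summit.ValiantsHypothesis.ValiantsHypothesis.Theorems.NewtonUnitEquations.TwoProducts.MomentRecord

variable {m n : ℕ}
variable {u v : Fin m → MvPolynomial (Fin 2) ℂ} {x : Fin n → Expo} {d : Fin 2 → ℤ}

/-- **`ValidWeight` gives `NegWeightUsed` for the data of the instance** (the repaired weight clause (R1)). [folklore] -/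
theorem negWeightUsed_of_validWeight (hu : ∀ j, coeff 0 (u j) = 0) (hv : ∀ j, coeff 0 (v j) = 0)
    (halph : ∀ e ∈ tailSupport u v, ∃ i, e = x i ∨ ∀ c, ((e c : ℕ) : ℤ) = shiftZ x d i c) {ξ : Fin 2 → ℝ}
    (hval : ValidWeight u v ξ) :
    NegWeightUsed (alphaOf u v x d u) (betaOf u v x d u) (alphaOf u v x d v) (betaOf u v x d v) x d ξ := by
  intro i
  constructor
  · rintro (⟨j, hj⟩ | ⟨j, hj⟩)
    · exact hval.1 j _ (exists_letter_of_alphaOf_ne_zero hu hv halph hj)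
    · exact hval.2 j _ (exists_letter_of_alphaOf_ne_zero hu hv halph hj)
  · rintro (⟨j, hj⟩ | ⟨j, hj⟩)
    · obtain ⟨e, he, hpt⟩ := exists_letter_of_betaOf_ne_zero hu hv halph hj
      rw [← hpt, wtZ_ιZ]; exact hval.1 j e he
    · obtain ⟨e, he, hpt⟩ := exists_letter_of_betaOf_ne_zero hu hv halph hj
      rw [← hpt, wtZ_ιZ]; exact hval.2 j e he


end NegUsed

/-! ## The record of a visible point -/

section Record
open Summit.ValiantsHypothesis.ValiantsHypothesis.Theorems.NewtonUnitEquations.TwoProducts.FormalLogLinearisation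
open Summit.ValiantsHypothesis.ValiantsHypothesis.Theorems.NewtonUnitEquations.TwoProducts.PlanarCell
open Summit.ValiantsHypothesis.ValiantsHypothesis.Theorems.NewtonUnitEquations.TwoProducts.MomentRecord

variable {m n : ℕ}
variable {u v : Fin m → MvPolynomial (Fin 2) ℂ} {x : Fin n → Expo} {d : Fin 2 → ℤ}

/-- The empty carrier multiset carries no layer: `layer k 0 = 0`. [folklore] -/
theorem layer_eq_zero_of_ydeg_eq_zero (α β α' β' : Fin m → Fin n → ℂ) {E : Option (Fin n) →₀ ℕ} (hE : ydeg E = 0) (k : ℕ) :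
    layer α β α' β' k (fun i => E (some i)) = 0 := by
  have h0 : ∀ i, E (some i) = 0 := fun i => by
    have := Finset.single_le_sum (f := fun i => E (some i)) (fun i _ => Nat.zero_le _) (Finset.mem_univ i)
    rw [show ∑ i, E (some i) = ydeg E from rfl, hE] at this
    exact Nat.le_zero.mp this
  simp only [layer, momentPoly, h0, pow_zero, Finset.prod_const_one, Finset.sum_const, Finset.card_univ, Fintype.card_fin,
    sub_self, Polynomial.coeff_zero]

/-- **THE RECORD OF A VISIBLE POINT.**  For a normalised instance with tail alphabet in `X ⊔ (X+d)`, carrier-dissociated to depth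
`m`, a valid weight `ξ` and a strict `ξ`-top `l` of `supp (∏(1+u) − ∏(1+v))`: the unique shallow upstairs exponent `E` over `l` is
LIVE for the data of the instance and STRICTLY HEAVIER than every other live exponent of any size. [folklore] -/
theorem exists_liveTop_of_isStrictTop (hu : ∀ j, coeff 0 (u j) = 0) (hv : ∀ j, coeff 0 (v j) = 0)
    (halph : ∀ e ∈ tailSupport u v, ∃ i, e = x i ∨ ∀ c, ((e c : ℕ) : ℤ) = shiftZ x d i c) (hdis : CarrierDissociated x d m)
    {ξ : Fin 2 → ℝ} (hval : ValidWeight u v ξ) {l : Expo} (htop : IsStrictTop ξ (↑(tailDiff u v).support) l) :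
    ∃ E : Option (Fin n) →₀ ℕ, ydeg E ≤ m ∧ E none ≤ ydeg E ∧ pt x d E = ιZ l ∧
      layer (alphaOf u v x d u) (betaOf u v x d u) (alphaOf u v x d v) (betaOf u v x d v) (E none) (fun i => E (some i)) ≠ 0 ∧
      ∀ E' : Option (Fin n) →₀ ℕ, E' ≠ E →
        layer (alphaOf u v x d u) (betaOf u v x d u) (alphaOf u v x d v) (betaOf u v x d v) (E' none) (fun i => E' (some i)) ≠ 0 →
          wtZ ξ (pt x d E') < wt ξ l := by
  classical
  -- names
  set L := tailSupport u v with hL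
  set κ := κw ξ x d with hκ
  set w₀ := wt ξ l with hw₀
  set αu := alphaOf u v x d u
  set βu := betaOf u v x d u
  set αv := alphaOf u v x d v
  set βv := betaOf u v x d v
  have h0 : (0 : Expo) ∉ L := zero_not_mem_tailSupport hu hv
  have huA : ∀ j, (u j).support ⊆ L := fun j e he => Finset.mem_union_left _ (Finset.mem_biUnion.mpr ⟨j, Finset.mem_univ _, he⟩)
  have hvA : ∀ j, (v j).support ⊆ L := fun j e he => Finset.mem_union_right _ (Finset.mem_biUnion.mpr ⟨j, Finset.mem_univ _, he⟩)
  -- (1) the visible point and its tuple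
  have hl : coeff l (tailDiff u v) ≠ 0 := mem_support_iff.mp (Finset.mem_coe.mp htop.1)
  obtain ⟨a₀, ha₀, hsum⟩ : ∃ a ∈ Fintype.piFinset (fun _ : Fin m => insert (0 : Expo) L), ∑ j, a j = l := by
    by_contra hne
    push Not at hne
    apply hl
    rw [tailDiff, coeff_sub, coeff_prod_one_add_eq_fibreSum u _ (fun _ => h0) huA,
      coeff_prod_one_add_eq_fibreSum v _ (fun _ => h0) hvA]
    have hempty : (Fintype.piFinset (fun _ : Fin m => insert (0 : Expo) L)).filter (fun a => ∑ j, a j = l) = ∅ :=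
      Finset.filter_eq_empty_iff.mpr fun a ha h => hne a ha h
    rw [hempty, Finset.sum_empty, Finset.sum_empty, sub_self]
  set E := ∑ j, lam u v x d (a₀ j) with hE
  obtain ⟨hEm, hEk⟩ := shallow_tupleExp halph a₀ (u := u) (v := v) (x := x) (d := d)
  have hptE : pt x d E = ιZ l := by
    rw [hE, pt_sum, ← hsum, ιZ_sum]
    refine Finset.sum_congr rfl fun j _ => pt_lam hu hv halph ?_
    exact Fintype.mem_piFinset.mp ha₀ j
  have hlwE : lw κ E = w₀ := by rw [hκ, lw_κw, hptE, wtZ_ιZ]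
  -- (2) up = down at `E`
  set G := coeff l (tailDiff u v) with hG
  have hcoeffE : coeff E (DeltaUp (u := u) (v := v) (x := x) (d := d)) = G := by
    rw [hE, coeff_deltaUp_tupleExp hu hv halph hdis ha₀, hsum]
  -- (3) the top congruence for 𝚫
  have htopΔ : TopEq κ w₀ (DeltaUp (u := u) (v := v) (x := x) (d := d)) (monomial E G) := by
    intro E' hE'
    rw [coeff_monomial]
    by_cases hc : coeff E' (DeltaUp (u := u) (v := v) (x := x) (d := d)) = 0
    · rw [hc]
      split_ifs with hEE
      · exact absurd (hEE ▸ hcoeffE) (by rw [hc]; exact Ne.symm hl)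
      · rfl
    · obtain ⟨b, hb, hbE⟩ := exists_tuple_of_coeff_deltaUp_ne_zero hu hv hc
      have hq : coeff (∑ j, b j) (tailDiff u v) ≠ 0 := by
        rwa [← hbE, coeff_deltaUp_tupleExp hu hv halph hdis hb] at hc
      have hptb : pt x d E' = ιZ (∑ j, b j) := by
        rw [← hbE, pt_sum, ιZ_sum]
        exact Finset.sum_congr rfl fun j _ => pt_lam hu hv halph (Fintype.mem_piFinset.mp hb j)
      have hwq : wt ξ (∑ j, b j) = lw κ E' := by rw [hκ, lw_κw, hptb, wtZ_ιZ]
      have hql : ∑ j, b j = l := by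
        by_contra hne
        have := htop.2 _ (Finset.mem_coe.mpr (mem_support_iff.mpr hq)) hne
        rw [hwq] at this
        exact absurd hE' (not_le.mpr this)
      have hEE : E' = E := by
        obtain ⟨s1, s2⟩ := shallow_tupleExp halph b (u := u) (v := v) (x := x) (d := d)
        rw [← hbE]
        refine pt_injOn_shallow hdis s1 s2 hEm hEk ?_
        rw [hbE, hptb, hql, hptE]
      subst hEE
      rw [if_pos rfl, hcoeffE]
  -- (4) tameness and the transport
  obtain ⟨c, hc, htame⟩ := exists_tame_liftW halph hval (u := u) (v := v) (x := x) (d := d)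
  have htU : ∀ j, Tame κ c (ellU (u := u) (v := v) (x := x) (d := d) j) := fun j => htame u j (huA j)
  have htV : ∀ j, Tame κ c (ellV (u := u) (v := v) (x := x) (d := d) j) := fun j => htame v j (hvA j)
  have hU0 : ∀ j, coeff 0 (ellU (u := u) (v := v) (x := x) (d := d) j) = 0 := by
    intro j
    rw [ellU, liftW, coeff_sum]
    refine Finset.sum_eq_zero fun e he => ?_
    rw [coeff_monomial, if_neg]
    intro h0e
    obtain ⟨_, hyd, _⟩ := (isLetterExp_lam halph (huA j he)).pt_eq (x := x) (d := d)
    rw [h0e] at hyd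
    simp [ydeg] at hyd
  have hV0 : ∀ j, coeff 0 (ellV (u := u) (v := v) (x := x) (d := d) j) = 0 := by
    intro j
    rw [ellV, liftW, coeff_sum]
    refine Finset.sum_eq_zero fun e he => ?_
    rw [coeff_monomial, if_neg]
    intro h0e
    obtain ⟨_, hyd, _⟩ := (isLetterExp_lam halph (hvA j he)).pt_eq (x := x) (d := d)
    rw [h0e] at hyd
    simp [ydeg] at hyd
  -- the transported congruence, for every admissible `R`, in LAYER form
  have hΛ : ∀ R : ℕ, -w₀ ≤ c * R → ∀ E' : Option (Fin n) →₀ ℕ, w₀ ≤ lw κ E' →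
      (if 1 ≤ ydeg E' ∧ ydeg E' ≤ R + 1 then ((-1 : ℂ) ^ (ydeg E' + 1) / (ydeg E' : ℂ)) *
        (Nat.multinomial Finset.univ (fun i => E' (some i)) : ℂ) * layer αu βu αv βv (E' none) (fun i => E' (some i)) else 0) =
      coeff E' (monomial E G) := by
    intro R hR E' hE'
    have ht := topEq_logT_of_topEq_prod hc Finset.univ Finset.univ _ _ hU0 hV0 htU htV hlwE htopΔ hR E' hE'
    simp_rw [ellU_eq_linForm halph, ellV_eq_linForm halph] at ht
    rw [coeff_logSum_linForm_sub] at ht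
    exact ht
  -- an admissible `R₀`
  obtain ⟨R₀, hR₀⟩ : ∃ R₀ : ℕ, -w₀ ≤ c * R₀ := by
    refine ⟨⌈-w₀ / c⌉₊, ?_⟩
    have h1 : -w₀ / c ≤ (⌈-w₀ / c⌉₊ : ℝ) := Nat.le_ceil _
    calc -w₀ = c * (-w₀ / c) := by field_simp
      _ ≤ c * ⌈-w₀ / c⌉₊ := by gcongr
  have hRmono : ∀ R : ℕ, R₀ ≤ R → -w₀ ≤ c * R := fun R hR =>
    hR₀.trans (by gcongr)
  -- (5) liveness
  have hEm' : ydeg E ≤ m := hEm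
  have hEk' : E none ≤ ydeg E := hEk
  have hydE : 1 ≤ ydeg E := by
    by_contra hlt
    have hy0 : ydeg E = 0 := by omega
    have hE0 : E = 0 := by
      ext w
      cases w with
      | none =>
        have h1 : E none ≤ 0 := hy0 ▸ hEk'
        exact Nat.le_zero.mp h1
      | some i =>
        have h1 := Finset.single_le_sum (f := fun i => E (some i)) (fun i _ => Nat.zero_le _) (Finset.mem_univ i)
        rw [show ∑ i, E (some i) = ydeg E from rfl, hy0] at h1
        exact Nat.le_zero.mp h1
    have hl0 : l = 0 := by
      apply ιZ_injective
      rw [← hptE, hE0, pt_zero, ιZ_zero]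
    apply hl
    rw [hG, hl0, tailDiff, coeff_sub, coeff_zero_prod_one_add _ _ hu, coeff_zero_prod_one_add _ _ hv, sub_self]
  have hlive : layer αu βu αv βv (E none) (fun i => E (some i)) ≠ 0 := by
    have h := hΛ (R₀ + m) (hRmono _ (Nat.le_add_right _ _)) E hlwE.ge
    rw [coeff_monomial, if_pos rfl, if_pos ⟨hydE, by omega⟩] at h
    intro h0
    rw [h0, mul_zero] at h
    exact hl h.symm
  refine ⟨E, hEm', hEk', hptE, hlive, fun E' hne hlive' => ?_⟩
  -- (6) the record inequality
  by_contra hge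
  rw [not_lt] at hge
  have hge' : w₀ ≤ lw κ E' := by rw [hκ, lw_κw]; exact hge
  have hyd' : 1 ≤ ydeg E' := by
    by_contra hlt
    exact hlive' (layer_eq_zero_of_ydeg_eq_zero _ _ _ _ (by omega) _)
  have h := hΛ (R₀ + ydeg E') (hRmono _ (Nat.le_add_right _ _)) E' hge'
  rw [coeff_monomial, if_neg (Ne.symm hne), if_pos ⟨hyd', by omega⟩] at h
  exact (mul_ne_zero (classConst_ne_zero hyd') hlive') h

/-- The pair `(S_E, k_E)` of an upstairs exponent and back. [folklore] -/
theorem pt_embS_add_single (S : Fin n → ℕ) (k : ℕ) : pt x d (embS S + Finsupp.single none k) = ptZ x d S k := by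
  rw [pt_eq_ptZ]
  congr 1
  · funext i; rw [embS_add_single_apply]; rfl
  · rw [embS_add_single_apply]; rfl

/-- **THE RECORD OF A VISIBLE POINT, in the landed vocabulary**: the shallow pair over a strict top is an `IsRecord` for the same
weight, which is `NegWeightUsed` for the data of the instance. [folklore] -/
theorem exists_isRecord_of_isStrictTop (hu : ∀ j, coeff 0 (u j) = 0) (hv : ∀ j, coeff 0 (v j) = 0)
    (halph : ∀ e ∈ tailSupport u v, ∃ i, e = x i ∨ ∀ c, ((e c : ℕ) : ℤ) = shiftZ x d i c) (hdis : CarrierDissociated x d m)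
    {ξ : Fin 2 → ℝ} (hval : ValidWeight u v ξ) {l : Expo} (htop : IsStrictTop ξ (↑(tailDiff u v).support) l) :
    ∃ p : (Fin n → ℕ) × ℕ, p ∈ shallowPairs n m ∧ ptZ x d p.1 p.2 = ιZ l ∧
      NegWeightUsed (alphaOf u v x d u) (betaOf u v x d u) (alphaOf u v x d v) (betaOf u v x d v) x d ξ ∧
      IsRecord (alphaOf u v x d u) (betaOf u v x d u) (alphaOf u v x d v) (betaOf u v x d v) x d m ξ p := by
  obtain ⟨E, hEm, hEk, hptE, hlive, hrec⟩ := exists_liveTop_of_isStrictTop hu hv halph hdis hval htop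
  refine ⟨(fun i => E (some i), E none), ?_, by rw [← pt_eq_ptZ, hptE], negWeightUsed_of_validWeight hu hv halph hval, ?_, ?_⟩
  · rw [shallowPairs, Finset.mem_product, Fintype.mem_piFinset]
    refine ⟨fun i => Finset.mem_range.mpr (Nat.lt_succ_of_le ?_), Finset.mem_range.mpr (Nat.lt_succ_of_le (hEk.trans hEm))⟩
    exact (Finset.single_le_sum (f := fun i => E (some i)) (fun i _ => Nat.zero_le _) (Finset.mem_univ i)).trans hEm
  · exact ⟨hEm, hEk, hlive⟩
  · rintro ⟨S', k'⟩ ⟨_, _, hlive'⟩ hne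
    set E' : Option (Fin n) →₀ ℕ := embS S' + Finsupp.single none k' with hE'
    have hS' : (fun i => E' (some i)) = S' := funext fun i => by rw [hE', embS_add_single_apply]; rfl
    have hk' : E' none = k' := by rw [hE', embS_add_single_apply]; rfl
    have hne' : E' ≠ E := by
      intro h
      apply hne
      rw [Prod.mk.injEq, ← hS', ← hk', h]
      exact ⟨rfl, rfl⟩
    have h := hrec E' hne' (by rw [hS', hk']; exact hlive')
    rw [hE', pt_embS_add_single] at h
    simp only
    rw [← pt_eq_ptZ, hptE, wtZ_ιZ]
    exact h

end Record

/-! ## Reindexing to the occurring carriers and the glue of record -/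

section Glue
open Summit.ValiantsHypothesis.ValiantsHypothesis.Theorems.NewtonUnitEquations.TwoProducts.FormalLogLinearisation
open Summit.ValiantsHypothesis.ValiantsHypothesis.Theorems.NewtonUnitEquations.TwoProducts.PlanarCell
open Summit.ValiantsHypothesis.ValiantsHypothesis.Theorems.NewtonUnitEquations.TwoProducts.MomentRecord

variable {m n : ℕ}

/-- Extension by zero of a carrier multiset on a sub-finset `C` of carriers, enumerated by `C.equivFin`. [folklore] -/
def extC (C : Finset (Fin n)) (S' : Fin C.card → ℕ) : Fin n → ℕ :=
  fun i => if h : i ∈ C then S' (C.equivFin ⟨i, h⟩) else 0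

/-- Sums against the extension by zero are sums over the sub-family. [folklore] -/
theorem sum_extC {M : Type*} [AddCommMonoid M] (C : Finset (Fin n)) (S' : Fin C.card → ℕ) (φ : Fin n → ℕ → M)
    (hφ : ∀ i, φ i 0 = 0) : ∑ i, φ i (extC C S' i) = ∑ i', φ (C.equivFin.symm i').1 (S' i') := by
  classical
  have h1 : ∑ i, φ i (extC C S' i) = ∑ i ∈ C, φ i (extC C S' i) := by
    refine (Finset.sum_subset (Finset.subset_univ C) fun i _ hi => ?_).symm
    rw [extC, dif_neg hi, hφ]
  rw [h1, ← Finset.sum_attach, ← Finset.univ_eq_attach, ← Equiv.sum_comp C.equivFin.symm]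
  refine Fintype.sum_congr _ _ fun i' => ?_
  rw [extC, dif_pos (C.equivFin.symm i').2]
  simp

/-- The extension recovers the sub-family on `C`. [folklore] -/
theorem extC_apply_symm (C : Finset (Fin n)) (S' : Fin C.card → ℕ) (i' : Fin C.card) :
    extC C S' (C.equivFin.symm i').1 = S' i' := by
  rw [extC, dif_pos (C.equivFin.symm i').2]
  simp

/-- `size` of the extension. [folklore] -/
theorem size_extC (C : Finset (Fin n)) (S' : Fin C.card → ℕ) : size (extC C S') = size S' := by
  rw [size, size, sum_extC C S' (fun _ k => k) fun _ => rfl]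

/-- `ptZ` of the extension is `ptZ` of the sub-family for the restricted carriers. [folklore] -/
theorem ptZ_extC (C : Finset (Fin n)) (x : Fin n → Expo) (d : Fin 2 → ℤ) (S' : Fin C.card → ℕ) (k : ℕ) :
    ptZ x d (extC C S') k = ptZ (fun i' => x (C.equivFin.symm i').1) d S' k := by
  ext c
  simp only [ptZ]
  congr 1
  exact sum_extC C S' (fun i k => ((k : ℕ) : ℤ) * ((x i c : ℕ) : ℤ)) fun i => by simp

/-- **Reindexing to the occurring carriers.**  The carriers that occur can be renumbered by `Fin n'` with `n' ≤ #tailSupport`, keeping the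
alphabet hypothesis and depth-`m` dissociation. [folklore] -/
theorem exists_reindex {u v : Fin m → MvPolynomial (Fin 2) ℂ} {x : Fin n → Expo} {d : Fin 2 → ℤ}
    (halph : ∀ e ∈ tailSupport u v, ∃ i, e = x i ∨ ∀ c, ((e c : ℕ) : ℤ) = shiftZ x d i c) (hdis : CarrierDissociated x d m) :
    ∃ (n' : ℕ) (x' : Fin n' → Expo), n' ≤ (tailSupport u v).card ∧
      (∀ e ∈ tailSupport u v, ∃ i, e = x' i ∨ ∀ c, ((e c : ℕ) : ℤ) = shiftZ x' d i c) ∧ CarrierDissociated x' d m := by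
  classical
  set L := tailSupport u v with hL
  set car : L → Fin n := fun e => Classical.choose (halph e.1 e.2) with hcar
  have hcar_spec : ∀ e : L, (e.1 = x (car e) ∨ ∀ c, ((e.1 c : ℕ) : ℤ) = shiftZ x d (car e) c) :=
    fun e => Classical.choose_spec (halph e.1 e.2)
  set C : Finset (Fin n) := L.attach.image car with hC
  set x' : Fin C.card → Expo := fun i' => x (C.equivFin.symm i').1 with hx'
  refine ⟨C.card, x', ?_, ?_, ?_⟩
  · exact Finset.card_image_le.trans (by rw [Finset.card_attach])
  · intro e he
    have hmem : car ⟨e, he⟩ ∈ C := Finset.mem_image.mpr ⟨⟨e, he⟩, Finset.mem_attach _ _, rfl⟩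
    refine ⟨C.equivFin ⟨car ⟨e, he⟩, hmem⟩, ?_⟩
    have hxe : x' (C.equivFin ⟨car ⟨e, he⟩, hmem⟩) = x (car ⟨e, he⟩) := by
      rw [hx']; simp
    rcases hcar_spec ⟨e, he⟩ with h | h
    · exact Or.inl (by rw [hxe]; exact h)
    · refine Or.inr fun c => ?_
      rw [shiftZ, hxe]
      exact h c
  · intro S₁ S₂ k₁ k₂ h1 h2 hk1 hk2 hpt
    have key := hdis (extC C S₁) (extC C S₂) k₁ k₂ (by rw [size_extC]; exact h1) (by rw [size_extC]; exact h2)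
      (by rw [size_extC]; exact hk1) (by rw [size_extC]; exact hk2) (by rw [ptZ_extC, ptZ_extC]; exact hpt)
    refine ⟨funext fun i' => ?_, key.2⟩
    rw [← extC_apply_symm C S₁ i', ← extC_apply_symm C S₂ i', key.1]

/-- **THE GLUE OF RECORD (R12): (A∘) `MomentRecordLawUsed` ⇒ the LANDED (B) `ShiftedCarrierLaw`**, with the same constants.
For each point `l` of a cell family the cell's valid weight `ξ_l` makes `l` a strict top of `logSupport`, hence (`stub_logLinearisation`)
of `supp (∏(1+u) − ∏(1+v))`, hence (`exists_isRecord_of_isStrictTop`, after reindexing to the `≤ 2mt` occurring carriers) the image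
of a RECORD with `NegWeightUsed`; points ↦ pairs is injective (`ptZ (pair) = l`).  Depth-`m` `CarrierDissociated` suffices; the repair
(R1) `NegWeightUsed` is necessary: for m = 2, `x = ((1,0),(0,1),(0,3))`, `d = (3,−1)` (`x₀ + d ∉ ℕ²`), `ξ = (−1,−5)` the visible point
`(4,0)` has 1 visible / 0 typed-`NegWeight` records in this presentation, and no orientation swap is typed because e.g. `2x₀ = 2x₁ + 3d`
is invisible to depth-2 dissociation yet breaks the flipped presentation (structural note, evidence #44 on 5906). [folklore] -/
theorem shiftedCarrier_of_lawUsed_holds : shiftedCarrier_of_lawUsed := by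
  classical
  rintro ⟨a, b, hlaw⟩
  refine ⟨a, b, fun m t n u v x d ht hu hv halph hdis R S hS => ?_⟩
  have hu0 : ∀ j, coeff 0 (u j) = 0 := fun j => (hu j).1
  have hv0 : ∀ j, coeff 0 (v j) = 0 := fun j => (hv j).1
  -- reindex to the occurring carriers
  obtain ⟨n', x', hn', halph', hdis'⟩ := exists_reindex halph hdis
  have hn'le : n' ≤ 2 * m * t :=
    hn'.trans (Summit.ValiantsHypothesis.ValiantsHypothesis.Theorems.NewtonUnitEquations.TwoProducts.Submerged.card_tailSupport_le u v t
      (fun j => (hu j).2) fun j => (hv j).2)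
  -- the data and the record set
  set αu := alphaOf u v x' d u
  set βu := betaOf u v x' d u
  set αv := alphaOf u v x' d v
  set βv := betaOf u v x' d v
  set Rec := (shallowPairs n' m).filter fun p => ∃ ξ : Fin 2 → ℝ, NegWeightUsed αu βu αv βv x' d ξ ∧ IsRecord αu βu αv βv x' d m ξ p
    with hRec
  have hbound : Rec.card ≤ 2 ^ (a * m) * (t + 2) ^ b := hlaw m n' t αu βu αv βv x' d ht hn'le
  -- each cell point has a record
  have hrec : ∀ l ∈ S, ∃ p ∈ Rec, ptZ x' d p.1 p.2 = ιZ l := by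
    intro l hl
    obtain ⟨ξ, hval, htop, -⟩ := hS l hl
    have htop' : IsStrictTop ξ (↑(tailDiff u v).support) l := (stub_logLinearisation m u v hu0 hv0 ξ hval l).2 htop
    obtain ⟨p, hp, hpt, hneg, hrecp⟩ := exists_isRecord_of_isStrictTop hu0 hv0 halph' hdis' hval htop'
    exact ⟨p, Finset.mem_filter.mpr ⟨hp, ξ, hneg, hrecp⟩, hpt⟩
  choose! rep hrep hptrep using hrec
  calc S.card ≤ Rec.card := Finset.card_le_card_of_injOn rep (fun l hl => hrep l hl) (fun l₁ h₁ l₂ h₂ h => by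
          apply ιZ_injective
          rw [← hptrep l₁ (Finset.mem_coe.mp h₁), ← hptrep l₂ (Finset.mem_coe.mp h₂), h])
    _ ≤ 2 ^ (a * m) * (t + 2) ^ b := hbound

end Glue

end RecordFile

end Summit.ValiantsHypothesis.ValiantsHypothesis.Theorems.NewtonUnitEquations.TwoProducts.MomentRecord.Lift

end
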